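import Mathlib
import Summits.Ventures.HodgeRepro.Tier4.Target
import Summits.Ventures.HodgeRepro.Tier4.Line3.KMDatum
import Summits.Ventures.HodgeRepro.Tier4.Line3.KMDatumS
import Summits.Ventures.HodgeRepro.Tier4.Line3.Defs
import Summits.Ventures.HodgeRepro.Tier4.Line3.DefsLemmas
import Summits.Ventures.HodgeRepro.Tier4.Line3.HeckeEquivarianceLemmas
import Summits.Ventures.HodgeRepro.Tier4.Line3.BallCoordLemmas
import Summits.Ventures.HodgeRepro.Tier4.Line3.StabFinite
import Summits.Ventures.HodgeRepro.Tier4.Line3.StabFiniteApi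
import Summits.Ventures.HodgeRepro.Tier4.Line3.ClassRegrouping
import Summits.Ventures.HodgeRepro.Tier4.Line3.CoefInvariance
import Summits.Ventures.HodgeRepro.Tier4.Line3.TorusInvariance
import Summits.Ventures.HodgeRepro.Tier4.Line3.MainClassReps
import Summits.Ventures.HodgeRepro.Tier4.Line3.ClassFibres
import Summits.Ventures.HodgeRepro.Tier4.Line3.CentreFibres
import Summits.Ventures.HodgeRepro.Tier4.Line3.CentreFinite

/-!
# Tier4/Line3/BaseClassWeight — L3.6c: the weight of the base class is bounded below uniformly over all levels

Blind re-derivation cell `pub-hodge-repro`, Tier 4 «PROVE THE STEP» (README §9–§10), LINE L3 (t4-plan-3 g2, Skeleton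
v0.30 873054357bfe77c9 · L392–L393 `baseClass`, L419–L422 `baseClass_weight`), seat t4-L3-p2 (lead S12781 / R-V S12860).
`baseClass K xm` is the `Γ′`-class of `lines xm` itself (the main class pinned by `main_one`); its weight in the class
sum is `w_{c₀} = |Z′_{Γ′}| / |Stab_{Γ′}(mainRep c₀)|`.  THE LEMMA: `w_{c₀} ≥ m₀ > 0` with `m₀` independent of the level.

PROOF.  `m₀ := 1 / |Stab_Γ(xm)|`, the stabiliser at the level `Γ` itself, finite by `finite_lineStab` (StabFinite.lean,
the (R-c) Kronecker argument) since `xm 0, xm 1` are independent (`linearIndependent_of_ballWedge hab`).  For a level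
`K = Γ′ ≤ Γ`: `centerCard K ≥ 1` (`1 ∈ Γ′` is a scalar; `centerCard_ne_zero`), `stabCard K (mainRep c₀) ≥ 1` (finite
by `finite_lineStab_mainRep`, non-empty by `1 ∈ Γ′`), and `stabCard K (mainRep c₀) ≤ |Stab_Γ(xm)|`: the chosen
representative `mainRep c₀` lies in the class of `lines xm`, so `lines (mainRep c₀) = lines (γ₁ • xm)` for some
`γ₁ ∈ Γ′` (`classOf_lines_mainRep`, `exists_mem_of_classOf_eq`), and `γ ↦ γ₁⁻¹ γ γ₁` injects `Stab_{Γ′}(mainRep c₀)`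
into `Stab_Γ(xm)` (`Γ′ ⊆ Γ`; the torus factor between `mainRep c₀` and `γ₁ • xm` is absorbed by `lines_smul` /
`exists_torus_of_lines_eq`).  Then `Re((a : ℂ) / (b : ℂ)) = a / b ≥ 1 / S` for naturals `1 ≤ a`, `1 ≤ b ≤ S`.

Nothing here says anything about the status of the Hodge conjecture for CM abelian varieties, which is NOT proved
(HC_CM is NOT proved by anyone in this repository).
-/

set_option autoImplicit false

noncomputable section

namespace Summit.Ventures.HodgeRepro.Tier4.Line3

open Summit.Ventures.HodgeRepro.Tier4
open Matrix

namespace T4Data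

variable (X : T4Data)

/-- The base class of the main orbit: the `Γ′`-class of `lines xm` itself (the term `main_one` pins). -/
def baseClass (K : X.Level) (xm : X.Tuple) : X.MainClass K xm :=
  ⟨X.classOf K (X.lines xm), X.orbitOf_out_classOf K (X.lines xm)⟩

/-! ## 1. Lines under a matrix: equality of line tuples is preserved by `x ↦ γ • x` -/

/-- If two tuples have the same line tuple, so do their images under any matrix. -/
theorem lines_mulVec_of_lines_eq {x x' : X.Tuple} (h : X.lines x = X.lines x') (γ : Matrix (Fin 3) (Fin 3) X.E) :
    X.lines (fun j => γ *ᵥ x j) = X.lines (fun j => γ *ᵥ x' j) := by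
  obtain ⟨t, ht, hx'⟩ := X.exists_torus_of_lines_eq h
  have h1 : (fun j => γ *ᵥ x' j) = fun j => t j • (γ *ᵥ x j) := by
    funext j
    rw [hx' j, Matrix.mulVec_smul]
  rw [h1, X.lines_smul t ht]

/-- The level `Γ` itself, as a level. -/
def levelTop : X.Level := ⟨X.Γ, X.hΓ, subset_rfl⟩

/-! ## 2. The stabiliser of the base representative injects into the stabiliser of `xm` at the level `Γ` -/

/-- `lines (mainRep K xm (baseClass K xm)) = lines (γ₁ • xm)` for some `γ₁ ∈ Γ′`. -/
theorem exists_mem_lines_mainRep_baseClass (K : X.Level) (xm : X.Tuple) :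
    ∃ γ₁ ∈ K.1, X.lines (X.mainRep K xm (X.baseClass K xm)) = X.lines (fun j => γ₁ *ᵥ xm j) := by
  have h : X.classOf K (X.lines xm) = X.classOf K (X.lines (X.mainRep K xm (X.baseClass K xm))) := by
    rw [X.classOf_lines_mainRep K xm (X.baseClass K xm)]
    rfl
  obtain ⟨γ₁, hγ₁, hw⟩ := X.exists_mem_of_classOf_eq K xm h
  exact ⟨γ₁, hγ₁, hw⟩

/-- The stabiliser in `Γ′` of the base representative injects into the stabiliser in `Γ` of `xm`. -/
theorem natCard_stab_baseClass_le (K : X.Level) (xm : X.Tuple)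
    (hx : LinearIndependent X.E ![xm 0, xm 1]) :
    Nat.card {γ : Matrix (Fin 3) (Fin 3) X.E // γ ∈ K.1 ∧
        X.lines (fun j => γ *ᵥ X.mainRep K xm (X.baseClass K xm) j) = X.lines (X.mainRep K xm (X.baseClass K xm))} ≤
      Nat.card {γ : Matrix (Fin 3) (Fin 3) X.E // γ ∈ X.Γ ∧ X.lines (fun j => γ *ᵥ xm j) = X.lines xm} := by
  haveI : Finite {γ : Matrix (Fin 3) (Fin 3) X.E // γ ∈ X.Γ ∧ X.lines (fun j => γ *ᵥ xm j) = X.lines xm} :=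
    X.finite_lineStab (X.levelTop) xm hx
  obtain ⟨γ₁, hγ₁, hl⟩ := X.exists_mem_lines_mainRep_baseClass K xm
  obtain ⟨δ, hδ, hγδ, hδγ⟩ := exists_inv_mem K.2.1 hγ₁
  set y := X.mainRep K xm (X.baseClass K xm) with hy
  -- the conjugation map
  refine Nat.card_le_card_of_injective
    (fun γ => ⟨δ * γ.1 * γ₁, ?_, ?_⟩) ?_
  · -- membership in Γ
    have hmul : δ * γ.1 * γ₁ ∈ K.1 := K.2.1.2.1 _ (K.2.1.2.1 _ hδ γ.1 γ.2.1) _ hγ₁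
    exact K.2.2 hmul
  · -- stabilises the lines of xm
    have h1 : X.lines (fun j => γ.1 *ᵥ y j) = X.lines y := γ.2.2
    -- transport along lines y = lines (γ₁ • xm)
    have h2 : X.lines (fun j => γ.1 *ᵥ (γ₁ *ᵥ xm j)) = X.lines (fun j => γ₁ *ᵥ xm j) := by
      have e1 := X.lines_mulVec_of_lines_eq hl γ.1
      rw [← e1, h1, hl]
    have h3 := X.lines_mulVec_of_lines_eq h2 δ
    simp only [Matrix.mulVec_mulVec] at h3
    rw [← Matrix.mul_assoc, hδγ] at h3
    have h4 : (fun j => (1 : Matrix (Fin 3) (Fin 3) X.E) *ᵥ xm j) = xm := by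
      funext j
      rw [Matrix.one_mulVec]
    rw [h4] at h3
    exact h3
  · intro γ γ' h
    have h' : δ * γ.1 * γ₁ = δ * γ'.1 * γ₁ := congrArg Subtype.val h
    apply Subtype.ext
    have this : γ₁ * (δ * γ.1 * γ₁) * δ = γ₁ * (δ * γ'.1 * γ₁) * δ := by rw [h']
    calc γ.1 = γ₁ * (δ * γ.1 * γ₁) * δ := by
          rw [show γ₁ * (δ * γ.1 * γ₁) * δ = (γ₁ * δ) * γ.1 * (γ₁ * δ) by noncomm_ring, hγδ, Matrix.one_mul,
            Matrix.mul_one]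
      _ = γ₁ * (δ * γ'.1 * γ₁) * δ := this
      _ = γ'.1 := by
          rw [show γ₁ * (δ * γ'.1 * γ₁) * δ = (γ₁ * δ) * γ'.1 * (γ₁ * δ) by noncomm_ring, hγδ, Matrix.one_mul,
            Matrix.mul_one]

/-! ## 3. The two cardinalities are at least `1` -/

/-- The stabiliser in `Γ′` of the base representative contains `1`, hence `stabCard ≥ 1`. -/
theorem one_le_stabCard_baseClass (K : X.Level) (xm : X.Tuple)
    (hab : X.ballCoord (xm 0) 0 * X.ballCoord (xm 1) 1 - X.ballCoord (xm 0) 1 * X.ballCoord (xm 1) 0 ≠ 0) :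
    1 ≤ X.stabCard K (X.mainRep K xm (X.baseClass K xm)) := by
  unfold T4Data.stabCard
  haveI : Finite {γ : Matrix (Fin 3) (Fin 3) X.E // γ ∈ K.1 ∧
      X.lines (fun j => γ *ᵥ X.mainRep K xm (X.baseClass K xm) j) = X.lines (X.mainRep K xm (X.baseClass K xm))} :=
    X.finite_lineStab_mainRep K xm hab (X.baseClass K xm)
  haveI : Nonempty {γ : Matrix (Fin 3) (Fin 3) X.E // γ ∈ K.1 ∧
      X.lines (fun j => γ *ᵥ X.mainRep K xm (X.baseClass K xm) j) = X.lines (X.mainRep K xm (X.baseClass K xm))} :=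
    ⟨⟨1, K.2.1.1, by simp only [Matrix.one_mulVec]⟩⟩
  exact Nat.card_pos

/-- The stabiliser in `Γ` of `xm` is finite and contains `1`. -/
theorem one_le_natCard_stab_top (xm : X.Tuple) (hx : LinearIndependent X.E ![xm 0, xm 1]) :
    1 ≤ Nat.card {γ : Matrix (Fin 3) (Fin 3) X.E // γ ∈ X.Γ ∧ X.lines (fun j => γ *ᵥ xm j) = X.lines xm} := by
  haveI : Finite {γ : Matrix (Fin 3) (Fin 3) X.E // γ ∈ X.Γ ∧ X.lines (fun j => γ *ᵥ xm j) = X.lines xm} :=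
    X.finite_lineStab X.levelTop xm hx
  haveI : Nonempty {γ : Matrix (Fin 3) (Fin 3) X.E // γ ∈ X.Γ ∧ X.lines (fun j => γ *ᵥ xm j) = X.lines xm} :=
    ⟨⟨1, X.hΓ.1, by simp only [Matrix.one_mulVec]⟩⟩
  exact Nat.card_pos

/-! ## 4. L3.6c -/

/-- **L3.6c THE WEIGHT OF THE BASE CLASS IS BOUNDED BELOW, uniformly over ALL levels (support item, t4-L3-p2; v0.29).**
`centerCard K ≥ 1` (`1 ∈ Γ′` is a scalar; the scalars of `Γ′` are roots of unity, finitely many: Kronecker on the entries,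
as in `finite_lineStab`); `mainRep K xm (baseClass K xm) = t • (γ₁ • xm)` for some `γ₁ ∈ Γ′` and torus `t` (the chosen
representative lies in the class of `lines xm`: `classOf_lines_mainRep` + `exists_mem_of_classOf_eq` +
`exists_torus_of_lines_eq`), so `Stab_{Γ′}(mainRep c₀) = γ₁ · Stab_{Γ′}(xm) · γ₁⁻¹` has the cardinality of
`Stab_{Γ′}(xm) ⊆ Stab_Γ(xm)` (`Γ′ ⊆ Γ`), finite by `finite_lineStab` at the level `Γ` itself (`⟨Γ, X.hΓ, subset_rfl⟩`); hence
`w_{c₀} ≥ 1 / |Stab_Γ(xm)| =: m₀` for every level.  (`Nat.card` conventions: both cardinalities are non-zero, so the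
quotient is a genuine positive rational.) -/
theorem baseClass_weight (xm : X.Tuple)
    (hab : X.ballCoord (xm 0) 0 * X.ballCoord (xm 1) 1 - X.ballCoord (xm 0) 1 * X.ballCoord (xm 1) 0 ≠ 0) :
    ∃ m₀ : ℝ, 0 < m₀ ∧ ∀ K : X.Level,
      m₀ ≤ ((X.centerCard K : ℂ) / (X.stabCard K (X.mainRep K xm (X.baseClass K xm)) : ℂ)).re := by
  have hx : LinearIndependent X.E ![xm 0, xm 1] := X.linearIndependent_of_ballWedge hab
  set S : ℕ := Nat.card {γ : Matrix (Fin 3) (Fin 3) X.E // γ ∈ X.Γ ∧ X.lines (fun j => γ *ᵥ xm j) = X.lines xm}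
    with hS
  have hS1 : 1 ≤ S := X.one_le_natCard_stab_top xm hx
  have hSpos : (0 : ℝ) < S := by exact_mod_cast hS1
  refine ⟨1 / (S : ℝ), by positivity, fun K => ?_⟩
  have ha : 1 ≤ X.centerCard K := Nat.one_le_iff_ne_zero.mpr (X.centerCard_ne_zero K)
  have hb1 : 1 ≤ X.stabCard K (X.mainRep K xm (X.baseClass K xm)) := X.one_le_stabCard_baseClass K xm hab
  have hbS : X.stabCard K (X.mainRep K xm (X.baseClass K xm)) ≤ S := by
    unfold T4Data.stabCard
    exact X.natCard_stab_baseClass_le K xm hx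
  set a : ℕ := X.centerCard K with hadef
  set b : ℕ := X.stabCard K (X.mainRep K xm (X.baseClass K xm)) with hbdef
  have hre : ((a : ℂ) / (b : ℂ)).re = (a : ℝ) / (b : ℝ) := by
    rw [← Complex.ofReal_natCast, ← Complex.ofReal_natCast, ← Complex.ofReal_div, Complex.ofReal_re]
  rw [hre]
  have ha' : (1 : ℝ) ≤ a := by exact_mod_cast ha
  have hb1' : (1 : ℝ) ≤ b := by exact_mod_cast hb1
  have hbS' : (b : ℝ) ≤ S := by exact_mod_cast hbS
  calc (1 : ℝ) / S ≤ 1 / (b : ℝ) := one_div_le_one_div_of_le (by linarith) hbS'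
    _ ≤ (a : ℝ) / (b : ℝ) := div_le_div_of_nonneg_right ha' (by linarith)

end T4Data

end Summit.Ventures.HodgeRepro.Tier4.Line3

end
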